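import Summits.HodgeConjecture.HodgeConjecture.Theorems.F0P3cStCharTSEPNormOneUnr             -- ★ row 59-F ED. 2 p853692 (F0P3-p01): §1 trunk + §2 `innerG_char_self_eq_one_of_unramified_explicit` (`hpc3 := ★ S2a`, ★ 61b inside)
import Summits.HodgeConjecture.HodgeConjecture.Theorems.F0P3cStCharTSK1UnrPseudoCoeffWitness  -- ★ row 58 FILE 1 p853680 (LH5-p02 g11): §0 sockets `iso_mapEdgeSet_eq_iff`, `exists_restrictRep_fixedPoints` + S2a
import Summits.HodgeConjecture.HodgeConjecture.Theorems.F0P3cStCharTSCharacterEllipticUniform  -- ★ 41g-H (LH6-p04): tree letters at the datum + `char_eq_fixedVertexSum_sub_fixedEdgeSum`; brings (G3)-EXPLICIT letters, `Gqs`, `EllipticData`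
import Summits.HodgeConjecture.HodgeConjecture.Theorems.F0P3cStCharTSEPGlueG                    -- ★ (G3) (LH10-p02): the letters-from-`hunr` pattern (`unramifiedLocalConjDatum_adicCompletion`, `localNonsplitEquiv`, `qsForm` re-reading)
import Summits.HodgeConjecture.HodgeConjecture.Theorems.F0P3cStCharTSEllMassG                   -- ★ (G4) (F0P3b-p01): the clause-2 PIN READER `orbInt_eq_zero_of_mem_regG_of_not_mem_ellG`
import Summits.HodgeConjecture.HodgeConjecture.Theorems.F0P3cStCharTSEllipticFixedTree           -- ★ row 53 p853423 (F0P3a-p09): (H5) `ellipticFixedTree_of_mem_ellG` (the tree binders `hne hfin hfinE` on `G^e`)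
import Summits.HodgeConjecture.HodgeConjecture.Theorems.F0P3cStCharTSEPFunctionOrbitalElliptic    -- ★ 48-datum FILE 2 p853465 (F0P3a-p01): `classOrbitalIntegral_epSum_eq_fixedVertexSum_sub_fixedEdgeSum` ((SS-O) at the datum)
import Summits.HodgeConjecture.HodgeConjecture.Theorems.F0P3cStCharTSEPNonEllipticVanishing       -- ★ 47e-E3 p853460 (LH6-p04): `classOrbitalIntegral_eq_zero_of_forall_smoothTrace_eq_zero` (van Dijk door, carries (o9))
import Summits.HodgeConjecture.HodgeConjecture.Theorems.F0P3cStCharTSEPInducedTraceZeroAtDatumDischarge  -- ★ row 61b (F0P3a-p04 g32 ∕ F0P2-p06): `smoothTrace_cmPrincipalSeries_epFunction_eq_zero` — all principal-series traces of `f_EP^{π,e}` vanish (the former `h61`)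
import Summits.HodgeConjecture.HodgeConjecture.Theorems.F0P3cStCharTSJacquetLine                  -- ★ JDIM2: `finrank_coinvariants_le_two` (the Jacquet module of an irreducible is finite-dimensional — ★ 61b's `hVN` at `r.ρ`)
import Literature.NumberTheory.Automorphic.SmoothCharacterEPFunctionTrace                         -- ★ row 42 (F0P2-p01): `Representation.mem_schwartzBruhat_of_kType` (clause 1)
import Literature.NumberTheory.Automorphic.SmoothCharacterFiniteOrder                             -- ★ row 51: `Representation.levelTrace_inv_eq_conj_of_mem_of_isCompact` ((c) UNIT∕DUAL, termwise)
import Literature.NumberTheory.Automorphic.UnitaryLatticeTreeLevelGroupsTopology                  -- ★ row 43 (LH5-p04): level groups are a neighbourhood basis (the level `e`)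
import Literature.NumberTheory.Automorphic.UnitaryLatticeTreeGeodesicApartment                    -- ★ 39γ: `exists_apartmentEnum`, `latticeGraph_adj_apartmentEnum_succ` (a base edge)
import Literature.NumberTheory.Automorphic.UnitaryGroupBorelInduction                             -- ★ `cmPrincipalSeries` (the `hsp` currency of 47e-E3 ∕ 47d-6b)
import Summits.HodgeConjecture.HodgeConjecture.Theorems.F0P3cStCharTSK2PrimeL2Tame             -- ★ 72-NW p853724 (LH6-p03 g10): §A-RAM `innerG_char_self_eq_one_of_neg_explicit` (tame trunk, ★ 61b-RAM inside); brings ★ 56-B1 apartment-of-involution, ★ H-RAM topology, ★ `ramifiedBlock_adicCompletion`, ★ `valued_two_eq_one_iff_of_placesOver`, ★ `isUnramifiedIn_of_ramificationIdx'_eq_one`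
import HarnessLib

/-!
# F0 · P3c · «StCharTS» — E1 ROW 73 «HSPLIT ⇒ EP-NORM-ONE IN THE JUNCTION'S LETTERS» (UNR ∕ TAME ∕ NOT-WILD): `⟨χ_⟦r⟧, χ_⟦r⟧⟩_e = 1` for every irreducible smooth `r` of `U(Φ₃)(L⁺_v)`
# whose smooth self-extensions split — the `hsplit`-socket through which every family head (K2′ `L²`, K4′ l.d.s., …) reaches the ★ EP trunks

Cell `pub/hodgecm-mathlib` (D-0151), crux H413 = `stmt-HodgeConjecture-24833` (`--supports … --as helper` lane); seat «LH5» LH5-p02 (g12); E1 keeper ∕ dealer F0P3a-p03 (g31)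
k82 «= GO-LOW, row 73».  THEOREMS ONLY (no definition ∕ instance ∕ notation ∕ named fact ∕ `sorry`).  HONEST LABEL: count-neutral glue (rider-class until an organ edition rides
through it); E1 = PRINT; h413 OPEN; HC_CM is proved only modulo the 7 printed citations (2 remaining named inputs: hLiu418 = stmt-HodgeConjecture-24832, h413 =
stmt-HodgeConjecture-24833) until rung 0 closes.  Nothing printed is asserted here.

WHY.  The ★ trunks (59-F ED. 2 §2 `EPNormOneUnr.innerG_char_self_eq_one_of_unramified_explicit`, 72-NW §A-RAM `K2PrimeL2Tame.innerG_char_self_eq_one_of_neg_explicit`) prove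
`⟨χ_⟦r⟧, χ_⟦r⟧⟩_e = 1` from `hsplit` in the (G3)-EXPLICIT letters PLUS a chosen level `e`, tree letters `a U`, an orientation, a base edge `d₁` with stabilisers `P₀ P₂ P₁`, a fixed
vector `he`, three `K`-type restrictions and their pieces `fᵢ`.  Those choices are the same for every family and were re-made verbatim inside each family head (★ 58 S2b, ★ 69,
★ 72 §B, ★ 72-NW §B-RAM); here they are made ONCE, with `hsplit` the only family binder and NO class letter (`IsL2` ∕ `IsEllipticRep` ∕ l.d.s. membership ∕ unitarity):
* §U `…_of_hsplit_of_unramified_explicit (hns) (w hw hd eA heA) … (r) (hsplit)` — ★ 58 S2b's construction VERBATIM then ★ 59-F ED. 2 §2;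
* §U′ `…_of_hsplit_of_unramified (hns) (hunr) … (r) (hsplit)` — junction letters (§U over the ★ (G3) letters-from-`hunr` block, as ★ 58 S1∕S3, ★ 72 §C);
* §R `…_of_hsplit_of_neg_explicit (hns) (w hw ‹hσ hvσ hϖ hσϖ hres h2 hnorm› eA heA) … (r) (hsplit)` — ★ 72-NW §B-RAM's construction VERBATIM then ★ 72-NW §A-RAM;
* §NW `…_of_hsplit_of_not_wild (hns) (hv : v unramified ∨ |2|_v = 1) … (r) (hsplit)` — junction letters under the NOT-WILD token (★ 72-NW §T1's case split over §U ∕ §R).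
CONSUMERS: the K4′ column — 68-I (UNR; `hsplit := 68-H` at a representative of a member of an l.d.s. packet, then §U′) and 68-I-NW (§NW); any later family supplies its own
`hsplit`.  Every supplier is ★ (59-F ED. 2 p853692, 58 FILE 1 p853680 with ★ 61b inside, 72-NW p853724 with ★ 58-W-RAM ∕ 61b-RAM inside, 41g-H, H-RAM, (G3), 43, 39γ, 56-B1).
## References
* [Rogawski1990] J. D. Rogawski, *Automorphic Representations of Unitary Groups in Three Variables*, Ann. of Math. Stud. 123 (1990), §12.5 pp. 182–187, §12.6 Prop. 12.6.1 (a) p. 188.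
* [SchneiderStuhler1997] P. Schneider, U. Stuhler, *Representation theory and sheaves on the Bruhat–Tits building*, Publ. Math. IHÉS 85 (1997), §III.4, Thm. III.4.16.
* [Kottwitz1988] R. Kottwitz, *Tamagawa numbers*, Ann. of Math. 127 (1988), §2.
* [BruhatTits1972] F. Bruhat, J. Tits, *Groupes réductifs sur un corps local I*, Publ. Math. IHÉS 41 (1972), §10.
-/

set_option autoImplicit false
-- the mandated namespace has the single-problem summit's repeated segment (`HodgeConjecture.HodgeConjecture`)
set_option linter.dupNamespace false
noncomputable section
open NumberField IsDedekindDomain MeasureTheory Filter Topology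
open scoped Matrix MatrixGroups Pointwise Valued WithZero ComplexConjugate
open Literature.NumberTheory.Rogawski1990 Literature.NumberTheory.Rogawski1990.Ch12Sec5
open Literature.NumberTheory.Automorphic Literature.NumberTheory.Automorphic.UnitaryGroup Literature.NumberTheory.Automorphic.UnitaryLatticeTree
open Literature.NumberTheory.Automorphic.HermitianLattice
open Literature.NumberTheory.GaloisRepresentations
open Literature.Combinatorics.SimpleGraph Literature.Combinatorics.SimpleGraph.OrientedIncidence

namespace Summit.HodgeConjecture.HodgeConjecture.Cruxes.H413.F0P3cStCharTSEPNormOneOfHsplit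
open Summit.HodgeConjecture.HodgeConjecture.Cruxes.H413 Summit.HodgeConjecture.HodgeConjecture.Cruxes.H413.F0P3cStCharTSTorusDefs Summit.HodgeConjecture.HodgeConjecture.Cruxes.H413.F0P3cStCharTSEPNormOneUnr
open Summit.HodgeConjecture.HodgeConjecture.Cruxes.H413.F0P3cStCharTSK1UnrPseudoCoeffWitness Summit.HodgeConjecture.HodgeConjecture.Cruxes.H413.F0P3cStCharTSK1PseudoCoeffWitnessRamified
open Literature.NumberTheory.Automorphic.Liu2021.LemD1IndexedNonVacuityTameSynthesis (isUnramifiedIn_of_ramificationIdx'_eq_one)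
variable (L : Type) [Field L] [NumberField L] [IsCMField L] (v : HeightOneSpectrum (𝓞 ↥(maximalRealSubfield L)))

/-! ## §U «HSPLIT ⇒ EP-NORM-ONE», (G3)-EXPLICIT letters at an UNRAMIFIED place: the level ∕ tree ∕ base-edge ∕ `K`-type choices made ONCE, `hsplit` the only family binder -/

set_option maxHeartbeats 1600000 in
-- instance-term unification on the CM local carriers and the vertex subtype (as ★ 58 S2b ∕ ★ 72 §B ∕ ★ 41g-H)
/-- **§U «HSPLIT ⇒ EP-NORM-ONE», (G3)-EXPLICIT letters.**  At a non-split UNRAMIFIED place `v` with the one-place model `(w hw ϖ hd eA heA)`, at a §12.5 datum `𝔇` with the junction pins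
`hμG horb hreg hE hM1` and ★ PCT-OUT's `hWIF hC1 hC2 hC3 hL2`: **for every irreducible smooth `r` of `U(Φ₃)(L⁺_v)` all of whose SMOOTH self-extensions split (`hsplit`, ★ 59-F's binder
VERBATIM), `⟨χ_⟦r⟧, χ_⟦r⟧⟩_e = 1`.**  Proof = ★ 58 S2b's construction VERBATIM (level `e` by ★ 43 below the open stabiliser of a non-zero vector at the apartment vertex `A 0` ★ 39γ, tree
letters ★ 41g-H §2, invariant orientation, base edge `A 0 — A 1`, stabilisers through `eA`, `K`-types ★ 58 FILE 1 §0, pieces by `dite`) then ★ 59-F ED. 2 §2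
`innerG_char_self_eq_one_of_unramified_explicit` with the given `hsplit`.  NO class letter (`IsL2` ∕ `IsEllipticRep` ∕ l.d.s. membership ∕ unitarity): the family enters only through `hsplit`.
[cite: Rogawski1990, §12.6 Prop. 12.6.1 (a) p. 188] [cite: SchneiderStuhler1997, Thm. III.4.16, §III.4] [cite: Kottwitz1988, §2] [cite: BruhatTits1972, §10] -/
theorem innerG_char_self_eq_one_of_hsplit_of_unramified_explicit
    (hns : ∀ w : PlacesOver L v, IsCMField.complexConj L • w.1 = w.1)
    (w : PlacesOver L v) (hw : IsCMField.complexConj L • w.1 = w.1) {ϖ : w.1.adicCompletion L} (hd : UnramifiedLocalConjDatum (galAdicCompletionMap (L := L) (IsCMField.complexConj L) hw) ϖ)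
    (eA : Gqs L v ≃ₜ* ↥(unitaryGroupOfForm (galAdicCompletionMap (L := L) (IsCMField.complexConj L) hw) ((StdForm.antidiagonal 3).over (w.1.adicCompletion L))))
    (heA : ∀ g : Gqs L v, ((eA g : ↥(unitaryGroupOfForm (galAdicCompletionMap (L := L) (IsCMField.complexConj L) hw) ((StdForm.antidiagonal 3).over (w.1.adicCompletion L)))) : GL (Fin 3) (w.1.adicCompletion L)) = ((localNonsplitEquiv (IsCMField.complexConj L) (qsForm L) (IsCMField.complexConj_ne_one L) w hw g : ↥(unitaryGroupOfForm (galAdicCompletionMap (L := L) (IsCMField.complexConj L) hw) (placeForm (qsForm L) w.1))) : GL (Fin 3) (w.1.adicCompletion L)))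
    [MeasurableSpace (Gqs L v)] [BorelSpace (Gqs L v)]
    [∀ γ : Gqs L v, MeasurableSpace (Gqs L v ⧸ Subgroup.centralizer ({γ} : Set (Gqs L v)))] [∀ γ : Gqs L v, BorelSpace (Gqs L v ⧸ Subgroup.centralizer ({γ} : Set (Gqs L v)))]
    [MeasurableSpace (Gqs L v ⧸ Subgroup.center (Gqs L v))]
    {H : Type} [Group H] [TopologicalSpace H] [IsTopologicalGroup H] [MeasurableSpace H]
    (νQv : Measure (Gqs L v)) [νQv.IsHaarMeasure] [νQv.IsMulRightInvariant] (mQv : OrbitalMeasureFamily (Gqs L v))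
    (hcanQ : mQv.IsCanonical (fun γ => IsRegularElt (γ.val : GL (Fin 3) (UnitaryGroup.LocalRing L v))) νQv)
    (𝔇 : EllipticData (Gqs L v) H) (hμG : 𝔇.μG = νQv) (horb : 𝔇.orb = mQv)
    (hreg : ∀ γ : Gqs L v, γ ∈ 𝔇.regG ↔ IsRegularElt (γ.val : GL (Fin 3) (UnitaryGroup.LocalRing L v)))
    (hE : ∀ γ : Gqs L v, γ ∈ 𝔇.ellG ↔ IsRegularElt (γ.val : GL (Fin 3) (UnitaryGroup.LocalRing L v)) ∧ γ ∉ hyperbolicSet L v)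
    (hM1 : ∀ π : IrrClass (Gqs L v), Measurable (𝔇.char π) ∧ LocallyIntegrable (𝔇.char π) 𝔇.μG ∧ (∀ x ∈ 𝔇.regG, ∀ᶠ y in 𝓝 x, 𝔇.char π y = 𝔇.char π x) ∧
      ∀ φ : Gqs L v → ℂ, IsLocSmooth φ → π.smoothTrace 𝔇.μG φ = ∫ x, φ x * 𝔇.char π x ∂𝔇.μG)
    (hWIF : 𝔇.WeylIntegrationFormula) (hC1 : 𝔇.EllCartanSubset) (hC2 : 𝔇.EllCartanAE) (hC3 : 𝔇.NonEllCartanAE) (hL2 : 𝔇.L2CharOnTorusAll)   -- ★ PCT-OUT's extra letters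
    (r : SmoothIrrep (Gqs L v))
    -- every SMOOTH self-extension of `r.ρ` splits (the ONLY family binder; ★ 59-F's text VERBATIM)
    (hsplit : ∀ (E : Type) [AddCommGroup E] [Module ℂ E] (ρE : Representation ℂ (Gqs L v) E), ρE.IsSmooth →
      ∀ (i : r.ρ.IntertwiningMap ρE) (p : ρE.IntertwiningMap r.ρ), Function.Injective i → LinearMap.ker p.toLinearMap = LinearMap.range i.toLinearMap →
        Function.Surjective p → ∃ s : r.ρ.IntertwiningMap ρE, p.comp s = Representation.IntertwiningMap.id r.ρ) :
    𝔇.innerG (𝔇.char (IrrClass.mk r)) (𝔇.char (IrrClass.mk r)) = 1 := by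
  classical
  haveI : r.ρ.IsIrreducible := r.isIrreducible
  haveI : NonarchimedeanGroup (Gqs L v) :=
    nonarchimedeanGroup_unitaryGroupOfForm_local (E := L) (c := IsCMField.complexConj L) (N := 3) (v := v) (J' := (adelicForm L 3 (qsForm L)).map (adeleToLocal L v))
  haveI := compactSpace_integer_adicCompletion L w.1
  have hadm : r.ρ.IsAdmissible := F0P3cStCharTSScTracePackage.isAdmissible_smoothIrrep L v hns r
  have hϖ0 : ϖ ≠ 0 := CartanUnique.uniformizer_ne_zero hd.vϖ
  have hϖ1 : Valued.v ϖ < 1 := by rw [hd.vϖ, ← WithZero.exp_zero]; exact WithZero.exp_lt_exp.2 (by norm_num)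
  -- (E) a non-zero vector, its open stabiliser, the base vertex `A 0` with a frame `g₀`, and the level `e` (★ 43)
  haveI : Nontrivial r.V := Representation.IsIrreducible.nontrivial r.ρ
  obtain ⟨v₁, hv₁⟩ := exists_ne (0 : r.V)
  have hSo : IsOpen ((r.ρ.stabilizerSubgroup v₁ : Subgroup (Gqs L v)) : Set (Gqs L v)) := r.isSmooth v₁
  obtain ⟨A, hA0, hA1⟩ := exists_apartmentEnum (σ := (galAdicCompletionMap (L := L) (IsCMField.complexConj L) hw)) hd
  obtain ⟨g₀, hg₀⟩ := exists_coe_eq_latt (galAdicCompletionMap (L := L) (IsCMField.complexConj L) hw) ϖ ((StdForm.antidiagonal 3).over (w.1.adicCompletion L)) (A 0)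
  have hWo : IsOpen ((eA.symm : ↥(unitaryGroupOfForm (galAdicCompletionMap (L := L) (IsCMField.complexConj L) hw) ((StdForm.antidiagonal 3).over (w.1.adicCompletion L))) → Gqs L v) ⁻¹' ((r.ρ.stabilizerSubgroup v₁ : Subgroup (Gqs L v)) : Set (Gqs L v))) :=
    hSo.preimage eA.symm.continuous
  have hW1 : (1 : ↥(unitaryGroupOfForm (galAdicCompletionMap (L := L) (IsCMField.complexConj L) hw) ((StdForm.antidiagonal 3).over (w.1.adicCompletion L)))) ∈ (eA.symm : ↥(unitaryGroupOfForm (galAdicCompletionMap (L := L) (IsCMField.complexConj L) hw) ((StdForm.antidiagonal 3).over (w.1.adicCompletion L))) → Gqs L v) ⁻¹' ((r.ρ.stabilizerSubgroup v₁ : Subgroup (Gqs L v)) : Set (Gqs L v)) := by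
    show eA.symm 1 ∈ ((r.ρ.stabilizerSubgroup v₁ : Subgroup (Gqs L v)) : Set (Gqs L v))
    rw [map_one]
    exact (r.ρ.stabilizerSubgroup v₁).one_mem
  obtain ⟨e', he', h43⟩ := exists_forall_map_sub_one_latt_le_scaleLattice_pow_imp_mem_unitary (galAdicCompletionMap (L := L) (IsCMField.complexConj L) hw) ((StdForm.antidiagonal 3).over (w.1.adicCompletion L)) hϖ0 hϖ1 g₀ hWo hW1 1
  obtain ⟨e, rfl⟩ : ∃ e : ℕ, e' = e + 1 := ⟨e' - 1, by omega⟩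
  -- (T) the tree letters at level `e` (★ 41g-H §2)
  obtain ⟨a, U, ha, hU⟩ := F0P3cStCharTSCharacterEllipticUniform.exists_actionHom_unitaryLevelFamily L v w hw eA e
  have hUo : ∀ x, IsOpen (U x : Set (Gqs L v)) := fun x => F0P3cStCharTSCharacterEllipticUniform.isOpen_coe_unitaryLevel_gqs hU hd x
  have hUc : ∀ x, IsCompact (U x : Set (Gqs L v)) := fun x => F0P3cStCharTSCharacterEllipticUniform.isCompact_coe_unitaryLevel_gqs hU hd x
  have he : ∃ x₀ : {M : Submodule 𝒪[(w.1.adicCompletion L)] (Fin 3 → (w.1.adicCompletion L)) // IsVertex (galAdicCompletionMap (L := L) (IsCMField.complexConj L) hw) ϖ ((StdForm.antidiagonal 3).over (w.1.adicCompletion L)) M}, r.ρ.fixedPoints (U x₀) ≠ ⊥ := by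
    refine ⟨A 0, (Submodule.ne_bot_iff _).2 ⟨v₁, ?_, hv₁⟩⟩
    rw [Representation.mem_fixedPoints]
    intro g hg
    obtain ⟨-, hle⟩ := (hU (A 0) g).1 hg
    rw [hg₀] at hle
    have hmem : eA.symm (eA g) ∈ ((r.ρ.stabilizerSubgroup v₁ : Subgroup (Gqs L v)) : Set (Gqs L v)) := h43 (eA g) hle
    rw [eA.symm_apply_apply] at hmem
    exact hmem
  -- (O) orientation, edge groups, base edge, stabilisers
  obtain ⟨τ, hτ⟩ := exists_orientation_latticeGraph (galAdicCompletionMap (L := L) (IsCMField.complexConj L) hw) ϖ ((StdForm.antidiagonal 3).over (w.1.adicCompletion L))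
  have hfixE : ∀ (g : Gqs L v) (d : (latticeGraph (galAdicCompletionMap (L := L) (IsCMField.complexConj L) hw) ϖ ((StdForm.antidiagonal 3).over (w.1.adicCompletion L))).edgeSet), (a g).mapEdgeSet d = d ↔ a g (τ.head d) = τ.head d ∧ a g (τ.tail d) = τ.tail d := fun g d => by
    have h := head_mapEdgeSet_latticeGraphIso (galAdicCompletionMap (L := L) (IsCMField.complexConj L) hw) ϖ ((StdForm.antidiagonal 3).over (w.1.adicCompletion L)) hτ (eA g) d
    rw [← ha] at h
    exact iso_mapEdgeSet_eq_iff τ (a g) d h.1 h.2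
  have hEo : ∀ d : (latticeGraph (galAdicCompletionMap (L := L) (IsCMField.complexConj L) hw) ϖ ((StdForm.antidiagonal 3).over (w.1.adicCompletion L))).edgeSet, IsOpen ((U (τ.head d) ⊔ U (τ.tail d) : Subgroup (Gqs L v)) : Set (Gqs L v)) := fun d =>
    F0P3cStCharTSCharacterEllipticUniform.isOpen_coe_sup_unitaryLevel_gqs hU hd _ _
  have hEc : ∀ d : (latticeGraph (galAdicCompletionMap (L := L) (IsCMField.complexConj L) hw) ϖ ((StdForm.antidiagonal 3).over (w.1.adicCompletion L))).edgeSet, IsCompact ((U (τ.head d) ⊔ U (τ.tail d) : Subgroup (Gqs L v)) : Set (Gqs L v)) := fun d =>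
    F0P3cStCharTSCharacterEllipticUniform.isCompact_coe_sup_unitaryLevel_gqs_of_adj hU hd (τ.adj_head_tail d)
  have hadj : (latticeGraph (galAdicCompletionMap (L := L) (IsCMField.complexConj L) hw) ϖ ((StdForm.antidiagonal 3).over (w.1.adicCompletion L))).Adj (A 0) (A 1) := by
    simpa using latticeGraph_adj_apartmentEnum_succ hd A hA0 hA1 0
  obtain ⟨d₁, hd₁⟩ : ∃ d₁ : (latticeGraph (galAdicCompletionMap (L := L) (IsCMField.complexConj L) hw) ϖ ((StdForm.antidiagonal 3).over (w.1.adicCompletion L))).edgeSet, (d₁ : Sym2 {M : Submodule 𝒪[(w.1.adicCompletion L)] (Fin 3 → (w.1.adicCompletion L)) // IsVertex (galAdicCompletionMap (L := L) (IsCMField.complexConj L) hw) ϖ ((StdForm.antidiagonal 3).over (w.1.adicCompletion L)) M}) = s(A 0, A 1) := ⟨⟨s(A 0, A 1), (SimpleGraph.mem_edgeSet _).2 hadj⟩, rfl⟩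
  have hstab : ∀ x : {M : Submodule 𝒪[(w.1.adicCompletion L)] (Fin 3 → (w.1.adicCompletion L)) // IsVertex (galAdicCompletionMap (L := L) (IsCMField.complexConj L) hw) ϖ ((StdForm.antidiagonal 3).over (w.1.adicCompletion L)) M}, ∃ P : Subgroup (Gqs L v), ∀ g, g ∈ P ↔ a g x = x := fun x => by
    obtain ⟨Q, hQ⟩ := exists_stabilizerSubgroup (galAdicCompletionMap (L := L) (IsCMField.complexConj L) hw) ϖ ((StdForm.antidiagonal 3).over (w.1.adicCompletion L)) x
    exact ⟨Q.comap eA.toMonoidHom, fun g => by rw [F0P3cStCharTSCharacterEllipticUniform.mem_comap_iff', hQ, ha]⟩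
  obtain ⟨P₀, hP₀⟩ := hstab (τ.head d₁)
  obtain ⟨P₂, hP₂⟩ := hstab (τ.tail d₁)
  obtain ⟨P₁, hP₁⟩ : ∃ P₁ : Subgroup (Gqs L v), ∀ g, g ∈ P₁ ↔ (a g).mapEdgeSet d₁ = d₁ :=
    ⟨P₀ ⊓ P₂, fun g => by rw [Subgroup.mem_inf, hP₀, hP₂, hfixE]⟩
  -- stabilisers inside normalisers (★ (U3)), for the `K`-types
  have hPU₀ : P₀ ≤ Subgroup.normalizer ((U (τ.head d₁) : Subgroup (Gqs L v)) : Set (Gqs L v)) := fun g hg =>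
    F0P3cStCharTSCharacterEllipticUniform.mem_normalizer_unitaryLevel_gqs_of_apply_eq ha hU ((hP₀ g).1 hg)
  have hPU₂ : P₂ ≤ Subgroup.normalizer ((U (τ.tail d₁) : Subgroup (Gqs L v)) : Set (Gqs L v)) := fun g hg =>
    F0P3cStCharTSCharacterEllipticUniform.mem_normalizer_unitaryLevel_gqs_of_apply_eq ha hU ((hP₂ g).1 hg)
  have hPU₁ : P₁ ≤ Subgroup.normalizer ((U (τ.head d₁) ⊔ U (τ.tail d₁) : Subgroup (Gqs L v)) : Set (Gqs L v)) := fun g hg =>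
    Subgroup.normalizer_inf_normalizer_le_normalizer_sup (U (τ.head d₁)) (U (τ.tail d₁))
      (Subgroup.mem_inf.2 ⟨F0P3cStCharTSCharacterEllipticUniform.mem_normalizer_unitaryLevel_gqs_of_apply_eq ha hU ((hfixE g d₁).1 ((hP₁ g).1 hg)).1,
        F0P3cStCharTSCharacterEllipticUniform.mem_normalizer_unitaryLevel_gqs_of_apply_eq ha hU ((hfixE g d₁).1 ((hP₁ g).1 hg)).2⟩)
  -- finite-dimensional fixed spaces (admissibility), the three `K`-type restrictions (§0), the three pieces
  haveI : FiniteDimensional ℂ ↥(r.ρ.fixedPoints (U (τ.head d₁))) := hadm.finite_fixedPoints ⟨U (τ.head d₁), hUo _⟩ (hUc _)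
  haveI : FiniteDimensional ℂ ↥(r.ρ.fixedPoints (U (τ.tail d₁))) := hadm.finite_fixedPoints ⟨U (τ.tail d₁), hUo _⟩ (hUc _)
  haveI : FiniteDimensional ℂ ↥(r.ρ.fixedPoints (U (τ.head d₁) ⊔ U (τ.tail d₁))) := hadm.finite_fixedPoints ⟨U (τ.head d₁) ⊔ U (τ.tail d₁), hEo d₁⟩ (hEc d₁)
  obtain ⟨τ₀, hτρ₀, hτ₀⟩ := exists_restrictRep_fixedPoints r.ρ P₀ (U (τ.head d₁)) hPU₀
  obtain ⟨τ₂, hτρ₂, hτ₂⟩ := exists_restrictRep_fixedPoints r.ρ P₂ (U (τ.tail d₁)) hPU₂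
  obtain ⟨τ₁, hτρ₁, hτ₁⟩ := exists_restrictRep_fixedPoints r.ρ P₁ (U (τ.head d₁) ⊔ U (τ.tail d₁)) hPU₁
  obtain ⟨f₀, hfP₀, hf0₀⟩ : ∃ f₀ : Gqs L v → ℂ, (∀ (g : Gqs L v) (hg : g ∈ P₀), f₀ g = Representation.character τ₀ ⟨g, hg⟩⁻¹) ∧ ∀ g ∉ P₀, f₀ g = 0 :=
    ⟨fun g => if hg : g ∈ P₀ then Representation.character τ₀ ⟨g, hg⟩⁻¹ else 0, fun g hg => dif_pos hg, fun g hg => dif_neg hg⟩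
  obtain ⟨f₂, hfP₂, hf0₂⟩ : ∃ f₂ : Gqs L v → ℂ, (∀ (g : Gqs L v) (hg : g ∈ P₂), f₂ g = Representation.character τ₂ ⟨g, hg⟩⁻¹) ∧ ∀ g ∉ P₂, f₂ g = 0 :=
    ⟨fun g => if hg : g ∈ P₂ then Representation.character τ₂ ⟨g, hg⟩⁻¹ else 0, fun g hg => dif_pos hg, fun g hg => dif_neg hg⟩
  obtain ⟨f₁, hfP₁, hf0₁⟩ : ∃ f₁ : Gqs L v → ℂ, (∀ (g : Gqs L v) (hg : g ∈ P₁), f₁ g = Representation.character τ₁ ⟨g, hg⟩⁻¹) ∧ ∀ g ∉ P₁, f₁ g = 0 :=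
    ⟨fun g => if hg : g ∈ P₁ then Representation.character τ₁ ⟨g, hg⟩⁻¹ else 0, fun g hg => dif_pos hg, fun g hg => dif_neg hg⟩
  exact innerG_char_self_eq_one_of_unramified_explicit L v hns w hw hd eA heA νQv mQv hcanQ 𝔇 hμG horb hreg hE hM1 hWIF hC1 hC2 hC3 hL2 ha τ hτ hU hUo hUc hEo hEc hA0 hA1 d₁ hd₁
    P₀ P₂ P₁ hP₀ hP₂ hP₁ r he τ₀ hτρ₀ hτ₀ τ₂ hτρ₂ hτ₂ τ₁ hτρ₁ hτ₁ hfP₀ hf0₀ hfP₂ hf0₂ hfP₁ hf0₁ hsplit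

/-! ## §U′ «HSPLIT ⇒ EP-NORM-ONE» IN THE JUNCTION'S LETTERS (§U over the ★ (G3) letters-from-`hunr` block, as ★ 58 S1∕S3 and ★ 72 §C) -/

/-- **§U′ «HSPLIT ⇒ EP-NORM-ONE», junction letters.**  At a non-split place `v` UNRAMIFIED in `L` (`hunr`), at the §12.5 datum with the junction pins and ★ PCT-OUT's letters: for every
irreducible smooth `r` whose smooth self-extensions split, `⟨χ_⟦r⟧, χ_⟦r⟧⟩_e = 1` — the (G3)-EXPLICIT letters exist because `v` is unramified (★ `unramifiedLocalConjDatum_adicCompletion`) and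
`G_v ≃ₜ* U(antidiag(1,1,1))(L_w)` (★ `localNonsplitEquiv` re-read on `Φ₃`, pattern of ★ (G3) `exists_epFunction_G` ∕ ★ 58 S1 ∕ ★ 72 §C).  This is the socket a K4′ head calls with
`hsplit := ‹68-H at a representative of a member of an l.d.s. packet›`. [cite: Rogawski1990, §12.6 Prop. 12.6.1 (a) p. 188] [cite: SchneiderStuhler1997, §III.4] [cite: Kottwitz1988, §2] -/
theorem innerG_char_self_eq_one_of_hsplit_of_unramified
    (hns : ∀ w : PlacesOver L v, IsCMField.complexConj L • w.1 = w.1) (hunr : Algebra.IsUnramifiedIn (𝓞 L) v.asIdeal)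
    [MeasurableSpace (Gqs L v)] [BorelSpace (Gqs L v)]
    [∀ γ : Gqs L v, MeasurableSpace (Gqs L v ⧸ Subgroup.centralizer ({γ} : Set (Gqs L v)))] [∀ γ : Gqs L v, BorelSpace (Gqs L v ⧸ Subgroup.centralizer ({γ} : Set (Gqs L v)))]
    [MeasurableSpace (Gqs L v ⧸ Subgroup.center (Gqs L v))]
    {H : Type} [Group H] [TopologicalSpace H] [IsTopologicalGroup H] [MeasurableSpace H]
    (νQv : Measure (Gqs L v)) [νQv.IsHaarMeasure] [νQv.IsMulRightInvariant] (mQv : OrbitalMeasureFamily (Gqs L v))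
    (hcanQ : mQv.IsCanonical (fun γ => IsRegularElt (γ.val : GL (Fin 3) (UnitaryGroup.LocalRing L v))) νQv)
    (𝔇 : EllipticData (Gqs L v) H) (hμG : 𝔇.μG = νQv) (horb : 𝔇.orb = mQv)
    (hreg : ∀ γ : Gqs L v, γ ∈ 𝔇.regG ↔ IsRegularElt (γ.val : GL (Fin 3) (UnitaryGroup.LocalRing L v)))
    (hE : ∀ γ : Gqs L v, γ ∈ 𝔇.ellG ↔ IsRegularElt (γ.val : GL (Fin 3) (UnitaryGroup.LocalRing L v)) ∧ γ ∉ hyperbolicSet L v)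
    (hM1 : ∀ π : IrrClass (Gqs L v), Measurable (𝔇.char π) ∧ LocallyIntegrable (𝔇.char π) 𝔇.μG ∧ (∀ x ∈ 𝔇.regG, ∀ᶠ y in 𝓝 x, 𝔇.char π y = 𝔇.char π x) ∧
      ∀ φ : Gqs L v → ℂ, IsLocSmooth φ → π.smoothTrace 𝔇.μG φ = ∫ x, φ x * 𝔇.char π x ∂𝔇.μG)
    (hWIF : 𝔇.WeylIntegrationFormula) (hC1 : 𝔇.EllCartanSubset) (hC2 : 𝔇.EllCartanAE) (hC3 : 𝔇.NonEllCartanAE) (hL2 : 𝔇.L2CharOnTorusAll)   -- ★ PCT-OUT's extra letters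
    (r : SmoothIrrep (Gqs L v))
    -- every SMOOTH self-extension of `r.ρ` splits (the ONLY family binder; ★ 59-F's text VERBATIM)
    (hsplit : ∀ (E : Type) [AddCommGroup E] [Module ℂ E] (ρE : Representation ℂ (Gqs L v) E), ρE.IsSmooth →
      ∀ (i : r.ρ.IntertwiningMap ρE) (p : ρE.IntertwiningMap r.ρ), Function.Injective i → LinearMap.ker p.toLinearMap = LinearMap.range i.toLinearMap →
        Function.Surjective p → ∃ s : r.ρ.IntertwiningMap ρE, p.comp s = Representation.IntertwiningMap.id r.ρ) :
    𝔇.innerG (𝔇.char (IrrClass.mk r)) (𝔇.char (IrrClass.mk r)) = 1 := by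
  obtain ⟨w⟩ : Nonempty (PlacesOver L v) := inferInstance
  have hw : IsCMField.complexConj L • w.1 = w.1 := hns w
  have hc1 : IsCMField.complexConj L ≠ 1 := IsCMField.complexConj_ne_one L
  -- the unramified datum at `w` (this is where `hunr` is spent)
  obtain ⟨ϖ, hd⟩ := unramifiedLocalConjDatum_adicCompletion (IsCMField.complexConj L) hc1 v w hw hunr
  -- the one-place model re-read on the literal form `Φ₃ = antidiag(1,1,1)` (★ (G3) :189–:196)
  have hJw : placeForm (qsForm L) w.1 = (StdForm.antidiagonal 3).over (w.1.adicCompletion L) := by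
    rw [placeForm, qsForm, antidiagOne_eq_over, StdForm.over_map]
  obtain ⟨eA, heA⟩ : ∃ eA : Gqs L v ≃ₜ* ↥(unitaryGroupOfForm (galAdicCompletionMap (L := L) (IsCMField.complexConj L) hw) ((StdForm.antidiagonal 3).over (w.1.adicCompletion L))),
      ∀ g : Gqs L v, ((eA g : ↥(unitaryGroupOfForm (galAdicCompletionMap (L := L) (IsCMField.complexConj L) hw) ((StdForm.antidiagonal 3).over (w.1.adicCompletion L)))) :
          GL (Fin 3) (w.1.adicCompletion L)) =
        ((localNonsplitEquiv (IsCMField.complexConj L) (qsForm L) hc1 w hw g :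
          ↥(unitaryGroupOfForm (galAdicCompletionMap (L := L) (IsCMField.complexConj L) hw) (placeForm (qsForm L) w.1))) : GL (Fin 3) (w.1.adicCompletion L)) := by
    rw [← hJw]
    exact ⟨localNonsplitEquiv (IsCMField.complexConj L) (qsForm L) hc1 w hw, fun g => rfl⟩
  exact innerG_char_self_eq_one_of_hsplit_of_unramified_explicit L v hns w hw hd eA heA νQv mQv hcanQ 𝔇 hμG horb hreg hE hM1 hWIF hC1 hC2 hC3 hL2 r hsplit

/-! ## §R «HSPLIT ⇒ EP-NORM-ONE», (G3)-EXPLICIT letters at a TAMELY RAMIFIED place (`hd` ↦ the seven tame letters IN SLOT; trunk = ★ 72-NW §A-RAM) -/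

set_option maxHeartbeats 1600000 in
-- instance-term unification on the CM local carriers and the vertex subtype (as ★ 72-NW §B-RAM ∕ ★ 69 (T2b) ∕ ★ 41g-H)
/-- **§R «HSPLIT ⇒ EP-NORM-ONE», (G3)-EXPLICIT letters at a TAMELY RAMIFIED place.**  Twin of §U with the unramified datum `hd` replaced IN ITS SLOT by the seven TAME letters
`hσ hvσ hϖ hσϖ hres h2 hnorm` of ★ `isTree_latticeGraph_three_of_neg` (★ B3(48)∕(53)∕(59) convention): **for every irreducible smooth `r` of `U(Φ₃)(L⁺_v)` all of whose SMOOTH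
self-extensions split (`hsplit`), `⟨χ_⟦r⟧, χ_⟦r⟧⟩_e = 1`.**  Proof = ★ 72-NW §B-RAM's construction VERBATIM (= ★ 69 (T2b)'s: level `e` by ★ 43 below the open stabiliser of a non-zero vector at
the apartment vertex `A 0` of ★ 56-B1, tree letters ★ 41g-H §2 with the ★ H-RAM topology, invariant orientation, base edge `A 0 — A 1`, stabilisers through `eA`, `K`-types ★ 58 FILE 1 §0,
pieces by `dite`) then ★ 72-NW §A-RAM `F0P3cStCharTSK2PrimeL2Tame.innerG_char_self_eq_one_of_neg_explicit` (its `h61` ⇐ ★ 61b-RAM inside) with the given `hsplit`.  NO class letter.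
[cite: Rogawski1990, §12.6 Prop. 12.6.1 (a) p. 188] [cite: SchneiderStuhler1997, Thm. III.4.16, §III.4] [cite: Kottwitz1988, §2] [cite: BruhatTits1972, §10] -/
theorem innerG_char_self_eq_one_of_hsplit_of_neg_explicit
    (hns : ∀ w : PlacesOver L v, IsCMField.complexConj L • w.1 = w.1)
    (w : PlacesOver L v) (hw : IsCMField.complexConj L • w.1 = w.1) {ϖ : w.1.adicCompletion L}
    (hσ : ∀ x, (galAdicCompletionMap (L := L) (IsCMField.complexConj L) hw) ((galAdicCompletionMap (L := L) (IsCMField.complexConj L) hw) x) = x)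
    (hvσ : ∀ x, Valued.v ((galAdicCompletionMap (L := L) (IsCMField.complexConj L) hw) x) = Valued.v x) (hϖ : Valued.v ϖ = WithZero.exp (-1 : ℤ))
    (hσϖ : (galAdicCompletionMap (L := L) (IsCMField.complexConj L) hw) ϖ = -ϖ)
    (hres : ∀ x : (w.1.adicCompletion L), Valued.v x ≤ 1 → Valued.v ((galAdicCompletionMap (L := L) (IsCMField.complexConj L) hw) x - x) < 1)
    (h2 : Valued.v (2 : (w.1.adicCompletion L)) = 1)
    (hnorm : ∀ u : (w.1.adicCompletion L), (galAdicCompletionMap (L := L) (IsCMField.complexConj L) hw) u = u → Valued.v (u - 1) < 1 →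
      ∃ z : (w.1.adicCompletion L), z * (galAdicCompletionMap (L := L) (IsCMField.complexConj L) hw) z = u ∧ Valued.v (z - 1) ≤ Valued.v (u - 1))
    (eA : Gqs L v ≃ₜ* ↥(unitaryGroupOfForm (galAdicCompletionMap (L := L) (IsCMField.complexConj L) hw) ((StdForm.antidiagonal 3).over (w.1.adicCompletion L))))
    (heA : ∀ g : Gqs L v, ((eA g : ↥(unitaryGroupOfForm (galAdicCompletionMap (L := L) (IsCMField.complexConj L) hw) ((StdForm.antidiagonal 3).over (w.1.adicCompletion L)))) : GL (Fin 3) (w.1.adicCompletion L)) = ((localNonsplitEquiv (IsCMField.complexConj L) (qsForm L) (IsCMField.complexConj_ne_one L) w hw g : ↥(unitaryGroupOfForm (galAdicCompletionMap (L := L) (IsCMField.complexConj L) hw) (placeForm (qsForm L) w.1))) : GL (Fin 3) (w.1.adicCompletion L)))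
    [MeasurableSpace (Gqs L v)] [BorelSpace (Gqs L v)]
    [∀ γ : Gqs L v, MeasurableSpace (Gqs L v ⧸ Subgroup.centralizer ({γ} : Set (Gqs L v)))] [∀ γ : Gqs L v, BorelSpace (Gqs L v ⧸ Subgroup.centralizer ({γ} : Set (Gqs L v)))]
    [MeasurableSpace (Gqs L v ⧸ Subgroup.center (Gqs L v))]
    {H : Type} [Group H] [TopologicalSpace H] [IsTopologicalGroup H] [MeasurableSpace H]
    (νQv : Measure (Gqs L v)) [νQv.IsHaarMeasure] [νQv.IsMulRightInvariant] (mQv : OrbitalMeasureFamily (Gqs L v))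
    (hcanQ : mQv.IsCanonical (fun γ => IsRegularElt (γ.val : GL (Fin 3) (UnitaryGroup.LocalRing L v))) νQv)
    (𝔇 : EllipticData (Gqs L v) H) (hμG : 𝔇.μG = νQv) (horb : 𝔇.orb = mQv)
    (hreg : ∀ γ : Gqs L v, γ ∈ 𝔇.regG ↔ IsRegularElt (γ.val : GL (Fin 3) (UnitaryGroup.LocalRing L v)))
    (hE : ∀ γ : Gqs L v, γ ∈ 𝔇.ellG ↔ IsRegularElt (γ.val : GL (Fin 3) (UnitaryGroup.LocalRing L v)) ∧ γ ∉ hyperbolicSet L v)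
    (hM1 : ∀ π : IrrClass (Gqs L v), Measurable (𝔇.char π) ∧ LocallyIntegrable (𝔇.char π) 𝔇.μG ∧ (∀ x ∈ 𝔇.regG, ∀ᶠ y in 𝓝 x, 𝔇.char π y = 𝔇.char π x) ∧
      ∀ φ : Gqs L v → ℂ, IsLocSmooth φ → π.smoothTrace 𝔇.μG φ = ∫ x, φ x * 𝔇.char π x ∂𝔇.μG)
    (hWIF : 𝔇.WeylIntegrationFormula) (hC1 : 𝔇.EllCartanSubset) (hC2 : 𝔇.EllCartanAE) (hC3 : 𝔇.NonEllCartanAE) (hL2 : 𝔇.L2CharOnTorusAll)   -- ★ PCT-OUT's extra letters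
    (r : SmoothIrrep (Gqs L v))
    -- every SMOOTH self-extension of `r.ρ` splits (the ONLY family binder; ★ 59-F's ∕ ★ (C)-RAM's text VERBATIM)
    (hsplit : ∀ (E : Type) [AddCommGroup E] [Module ℂ E] (ρE : Representation ℂ (Gqs L v) E), ρE.IsSmooth →
      ∀ (i : r.ρ.IntertwiningMap ρE) (p : ρE.IntertwiningMap r.ρ), Function.Injective i → LinearMap.ker p.toLinearMap = LinearMap.range i.toLinearMap →
        Function.Surjective p → ∃ s : r.ρ.IntertwiningMap ρE, p.comp s = Representation.IntertwiningMap.id r.ρ) :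
    𝔇.innerG (𝔇.char (IrrClass.mk r)) (𝔇.char (IrrClass.mk r)) = 1 := by
  classical
  haveI : r.ρ.IsIrreducible := r.isIrreducible
  haveI : NonarchimedeanGroup (Gqs L v) :=
    nonarchimedeanGroup_unitaryGroupOfForm_local (E := L) (c := IsCMField.complexConj L) (N := 3) (v := v) (J' := (adelicForm L 3 (qsForm L)).map (adeleToLocal L v))
  haveI := compactSpace_integer_adicCompletion L w.1
  have hadm : r.ρ.IsAdmissible := F0P3cStCharTSScTracePackage.isAdmissible_smoothIrrep L v hns r
  have hϖ0 : ϖ ≠ 0 := CartanUnique.uniformizer_ne_zero hϖ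
  have hϖ1 : Valued.v ϖ < 1 := by rw [hϖ, ← WithZero.exp_zero]; exact WithZero.exp_lt_exp.2 (by norm_num)
  -- (E) a non-zero vector, its open stabiliser, the base vertex `A 0` with a frame `g₀`, and the level `e` (★ 43)
  haveI : Nontrivial r.V := Representation.IsIrreducible.nontrivial r.ρ
  obtain ⟨v₁, hv₁⟩ := exists_ne (0 : r.V)
  have hSo : IsOpen ((r.ρ.stabilizerSubgroup v₁ : Subgroup (Gqs L v)) : Set (Gqs L v)) := r.isSmooth v₁
  obtain ⟨A, hA0, hA1⟩ := exists_apartmentEnum_of_involution hσ hvσ hϖ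
  obtain ⟨g₀, hg₀⟩ := exists_coe_eq_latt (galAdicCompletionMap (L := L) (IsCMField.complexConj L) hw) ϖ ((StdForm.antidiagonal 3).over (w.1.adicCompletion L)) (A 0)
  have hWo : IsOpen ((eA.symm : ↥(unitaryGroupOfForm (galAdicCompletionMap (L := L) (IsCMField.complexConj L) hw) ((StdForm.antidiagonal 3).over (w.1.adicCompletion L))) → Gqs L v) ⁻¹' ((r.ρ.stabilizerSubgroup v₁ : Subgroup (Gqs L v)) : Set (Gqs L v))) :=
    hSo.preimage eA.symm.continuous
  have hW1 : (1 : ↥(unitaryGroupOfForm (galAdicCompletionMap (L := L) (IsCMField.complexConj L) hw) ((StdForm.antidiagonal 3).over (w.1.adicCompletion L)))) ∈ (eA.symm : ↥(unitaryGroupOfForm (galAdicCompletionMap (L := L) (IsCMField.complexConj L) hw) ((StdForm.antidiagonal 3).over (w.1.adicCompletion L))) → Gqs L v) ⁻¹' ((r.ρ.stabilizerSubgroup v₁ : Subgroup (Gqs L v)) : Set (Gqs L v)) := by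
    show eA.symm 1 ∈ ((r.ρ.stabilizerSubgroup v₁ : Subgroup (Gqs L v)) : Set (Gqs L v))
    rw [map_one]
    exact (r.ρ.stabilizerSubgroup v₁).one_mem
  obtain ⟨e', he', h43⟩ := exists_forall_map_sub_one_latt_le_scaleLattice_pow_imp_mem_unitary (galAdicCompletionMap (L := L) (IsCMField.complexConj L) hw) ((StdForm.antidiagonal 3).over (w.1.adicCompletion L)) hϖ0 hϖ1 g₀ hWo hW1 1
  obtain ⟨e, rfl⟩ : ∃ e : ℕ, e' = e + 1 := ⟨e' - 1, by omega⟩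
  -- (T) the tree letters at level `e` (★ 41g-H §2)
  obtain ⟨a, U, ha, hU⟩ := F0P3cStCharTSCharacterEllipticUniform.exists_actionHom_unitaryLevelFamily L v w hw eA e
  have hUo : ∀ x, IsOpen (U x : Set (Gqs L v)) := fun x => F0P3cStCharTSCharacterEllipticUniformRamified.isOpen_coe_unitaryLevel_gqs_of_involution (eA := eA) hU hϖ x
  have hUc : ∀ x, IsCompact (U x : Set (Gqs L v)) := fun x => F0P3cStCharTSCharacterEllipticUniformRamified.isCompact_coe_unitaryLevel_gqs_of_involution (eA := eA) hU hϖ x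
  have he : ∃ x₀ : {M : Submodule 𝒪[(w.1.adicCompletion L)] (Fin 3 → (w.1.adicCompletion L)) // IsVertex (galAdicCompletionMap (L := L) (IsCMField.complexConj L) hw) ϖ ((StdForm.antidiagonal 3).over (w.1.adicCompletion L)) M}, r.ρ.fixedPoints (U x₀) ≠ ⊥ := by
    refine ⟨A 0, (Submodule.ne_bot_iff _).2 ⟨v₁, ?_, hv₁⟩⟩
    rw [Representation.mem_fixedPoints]
    intro g hg
    obtain ⟨-, hle⟩ := (hU (A 0) g).1 hg
    rw [hg₀] at hle
    have hmem : eA.symm (eA g) ∈ ((r.ρ.stabilizerSubgroup v₁ : Subgroup (Gqs L v)) : Set (Gqs L v)) := h43 (eA g) hle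
    rw [eA.symm_apply_apply] at hmem
    exact hmem
  -- (O) orientation, edge groups, base edge, stabilisers
  obtain ⟨τ, hτ⟩ := exists_orientation_latticeGraph (galAdicCompletionMap (L := L) (IsCMField.complexConj L) hw) ϖ ((StdForm.antidiagonal 3).over (w.1.adicCompletion L))
  have hfixE : ∀ (g : Gqs L v) (d : (latticeGraph (galAdicCompletionMap (L := L) (IsCMField.complexConj L) hw) ϖ ((StdForm.antidiagonal 3).over (w.1.adicCompletion L))).edgeSet), (a g).mapEdgeSet d = d ↔ a g (τ.head d) = τ.head d ∧ a g (τ.tail d) = τ.tail d := fun g d =>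
    F0P3cStCharTSEPFunctionOrbitalOrbits.mapEdgeSet_eq_iff L v w hw eA ha τ hτ g d
  have hEo : ∀ d : (latticeGraph (galAdicCompletionMap (L := L) (IsCMField.complexConj L) hw) ϖ ((StdForm.antidiagonal 3).over (w.1.adicCompletion L))).edgeSet, IsOpen ((U (τ.head d) ⊔ U (τ.tail d) : Subgroup (Gqs L v)) : Set (Gqs L v)) := fun d =>
    F0P3cStCharTSCharacterEllipticUniformRamified.isOpen_coe_sup_unitaryLevel_gqs_of_involution (eA := eA) hU hϖ _ _
  have hEc : ∀ d : (latticeGraph (galAdicCompletionMap (L := L) (IsCMField.complexConj L) hw) ϖ ((StdForm.antidiagonal 3).over (w.1.adicCompletion L))).edgeSet, IsCompact ((U (τ.head d) ⊔ U (τ.tail d) : Subgroup (Gqs L v)) : Set (Gqs L v)) := fun d =>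
    F0P3cStCharTSCharacterEllipticUniformRamified.isCompact_coe_sup_unitaryLevel_gqs_of_adj_of_involution (eA := eA) hU hvσ hϖ (τ.adj_head_tail d)
  have hadj : (latticeGraph (galAdicCompletionMap (L := L) (IsCMField.complexConj L) hw) ϖ ((StdForm.antidiagonal 3).over (w.1.adicCompletion L))).Adj (A 0) (A 1) := by
    simpa using latticeGraph_adj_apartmentEnum_succ_of_involution hσ hvσ hϖ A hA0 hA1 0
  obtain ⟨d₁, hd₁⟩ : ∃ d₁ : (latticeGraph (galAdicCompletionMap (L := L) (IsCMField.complexConj L) hw) ϖ ((StdForm.antidiagonal 3).over (w.1.adicCompletion L))).edgeSet, (d₁ : Sym2 {M : Submodule 𝒪[(w.1.adicCompletion L)] (Fin 3 → (w.1.adicCompletion L)) // IsVertex (galAdicCompletionMap (L := L) (IsCMField.complexConj L) hw) ϖ ((StdForm.antidiagonal 3).over (w.1.adicCompletion L)) M}) = s(A 0, A 1) := ⟨⟨s(A 0, A 1), (SimpleGraph.mem_edgeSet _).2 hadj⟩, rfl⟩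
  have hstab : ∀ x : {M : Submodule 𝒪[(w.1.adicCompletion L)] (Fin 3 → (w.1.adicCompletion L)) // IsVertex (galAdicCompletionMap (L := L) (IsCMField.complexConj L) hw) ϖ ((StdForm.antidiagonal 3).over (w.1.adicCompletion L)) M}, ∃ P : Subgroup (Gqs L v), ∀ g, g ∈ P ↔ a g x = x := fun x => by
    obtain ⟨Q, hQ⟩ := exists_stabilizerSubgroup (galAdicCompletionMap (L := L) (IsCMField.complexConj L) hw) ϖ ((StdForm.antidiagonal 3).over (w.1.adicCompletion L)) x
    exact ⟨Q.comap eA.toMonoidHom, fun g => by rw [F0P3cStCharTSCharacterEllipticUniform.mem_comap_iff', hQ, ha]⟩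
  obtain ⟨P₀, hP₀⟩ := hstab (τ.head d₁)
  obtain ⟨P₂, hP₂⟩ := hstab (τ.tail d₁)
  obtain ⟨P₁, hP₁⟩ : ∃ P₁ : Subgroup (Gqs L v), ∀ g, g ∈ P₁ ↔ (a g).mapEdgeSet d₁ = d₁ :=
    ⟨P₀ ⊓ P₂, fun g => by rw [Subgroup.mem_inf, hP₀, hP₂, hfixE]⟩
  -- stabilisers inside normalisers (★ (U3)), for the `K`-types
  have hPU₀ : P₀ ≤ Subgroup.normalizer ((U (τ.head d₁) : Subgroup (Gqs L v)) : Set (Gqs L v)) := fun g hg =>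
    F0P3cStCharTSCharacterEllipticUniform.mem_normalizer_unitaryLevel_gqs_of_apply_eq ha hU ((hP₀ g).1 hg)
  have hPU₂ : P₂ ≤ Subgroup.normalizer ((U (τ.tail d₁) : Subgroup (Gqs L v)) : Set (Gqs L v)) := fun g hg =>
    F0P3cStCharTSCharacterEllipticUniform.mem_normalizer_unitaryLevel_gqs_of_apply_eq ha hU ((hP₂ g).1 hg)
  have hPU₁ : P₁ ≤ Subgroup.normalizer ((U (τ.head d₁) ⊔ U (τ.tail d₁) : Subgroup (Gqs L v)) : Set (Gqs L v)) := fun g hg =>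
    Subgroup.normalizer_inf_normalizer_le_normalizer_sup (U (τ.head d₁)) (U (τ.tail d₁))
      (Subgroup.mem_inf.2 ⟨F0P3cStCharTSCharacterEllipticUniform.mem_normalizer_unitaryLevel_gqs_of_apply_eq ha hU ((hfixE g d₁).1 ((hP₁ g).1 hg)).1,
        F0P3cStCharTSCharacterEllipticUniform.mem_normalizer_unitaryLevel_gqs_of_apply_eq ha hU ((hfixE g d₁).1 ((hP₁ g).1 hg)).2⟩)
  -- finite-dimensional fixed spaces (admissibility), the three `K`-type restrictions (§0), the three pieces
  haveI : FiniteDimensional ℂ ↥(r.ρ.fixedPoints (U (τ.head d₁))) := hadm.finite_fixedPoints ⟨U (τ.head d₁), hUo _⟩ (hUc _)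
  haveI : FiniteDimensional ℂ ↥(r.ρ.fixedPoints (U (τ.tail d₁))) := hadm.finite_fixedPoints ⟨U (τ.tail d₁), hUo _⟩ (hUc _)
  haveI : FiniteDimensional ℂ ↥(r.ρ.fixedPoints (U (τ.head d₁) ⊔ U (τ.tail d₁))) := hadm.finite_fixedPoints ⟨U (τ.head d₁) ⊔ U (τ.tail d₁), hEo d₁⟩ (hEc d₁)
  obtain ⟨τ₀, hτρ₀, hτ₀⟩ := exists_restrictRep_fixedPoints r.ρ P₀ (U (τ.head d₁)) hPU₀
  obtain ⟨τ₂, hτρ₂, hτ₂⟩ := exists_restrictRep_fixedPoints r.ρ P₂ (U (τ.tail d₁)) hPU₂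
  obtain ⟨τ₁, hτρ₁, hτ₁⟩ := exists_restrictRep_fixedPoints r.ρ P₁ (U (τ.head d₁) ⊔ U (τ.tail d₁)) hPU₁
  obtain ⟨f₀, hfP₀, hf0₀⟩ : ∃ f₀ : Gqs L v → ℂ, (∀ (g : Gqs L v) (hg : g ∈ P₀), f₀ g = Representation.character τ₀ ⟨g, hg⟩⁻¹) ∧ ∀ g ∉ P₀, f₀ g = 0 :=
    ⟨fun g => if hg : g ∈ P₀ then Representation.character τ₀ ⟨g, hg⟩⁻¹ else 0, fun g hg => dif_pos hg, fun g hg => dif_neg hg⟩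
  obtain ⟨f₂, hfP₂, hf0₂⟩ : ∃ f₂ : Gqs L v → ℂ, (∀ (g : Gqs L v) (hg : g ∈ P₂), f₂ g = Representation.character τ₂ ⟨g, hg⟩⁻¹) ∧ ∀ g ∉ P₂, f₂ g = 0 :=
    ⟨fun g => if hg : g ∈ P₂ then Representation.character τ₂ ⟨g, hg⟩⁻¹ else 0, fun g hg => dif_pos hg, fun g hg => dif_neg hg⟩
  obtain ⟨f₁, hfP₁, hf0₁⟩ : ∃ f₁ : Gqs L v → ℂ, (∀ (g : Gqs L v) (hg : g ∈ P₁), f₁ g = Representation.character τ₁ ⟨g, hg⟩⁻¹) ∧ ∀ g ∉ P₁, f₁ g = 0 :=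
    ⟨fun g => if hg : g ∈ P₁ then Representation.character τ₁ ⟨g, hg⟩⁻¹ else 0, fun g hg => dif_pos hg, fun g hg => dif_neg hg⟩
  exact F0P3cStCharTSK2PrimeL2Tame.innerG_char_self_eq_one_of_neg_explicit L v hns w hw hσ hvσ hϖ hσϖ hres h2 hnorm eA heA νQv mQv hcanQ 𝔇 hμG horb hreg hE hM1 hWIF hC1 hC2 hC3 hL2 ha τ hτ hU hUo hUc
    hEo hEc hA0 hA1 d₁ hd₁ P₀ P₂ P₁ hP₀ hP₂ hP₁ r he τ₀ hτρ₀ hτ₀ τ₂ hτρ₂ hτ₂ τ₁ hτρ₁ hτ₁ hfP₀ hf0₀ hfP₂ hf0₂ hfP₁ hf0₁ hsplit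

/-! ## §NW «HSPLIT ⇒ EP-NORM-ONE» UNDER THE NOT-WILD PLACE TOKEN, junction letters (the ★ (G3)-NOT-WILD ∕ ★ 69 (T1) ∕ ★ 72-NW §T1 case split over §U and §R) -/

/-- **§NW «HSPLIT ⇒ EP-NORM-ONE», junction letters, NOT-WILD place token.**  At a non-split place `v` with `hv : v unramified in L ∨ |2|_v = 1`, at the §12.5 datum with the junction pins
and ★ PCT-OUT's letters: for every irreducible smooth `r` whose smooth self-extensions split, `⟨χ_⟦r⟧, χ_⟦r⟧⟩_e = 1`.  Pick `w ∣ v` and the one-place model `eA` (★ `localNonsplitEquiv`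
re-read on `Φ₃`); if `v` is unramified, ★ `unramifiedLocalConjDatum_adicCompletion` and §U; else `e(w∣v) = 1` is again unramified (★ `isUnramifiedIn_of_ramificationIdx'_eq_one`), and
`e(w∣v) ≠ 1` with `|2|_w = 1` (★ `valued_two_eq_one_iff_of_placesOver`) gives the tame block (★ `ramifiedBlock_adicCompletion`) with the place-free `σσ = 1` ∕ `|σ·| = |·|`
(★ `galAdicCompletionMap_galAdicCompletionMap_of_smul_eq`, ★ `valued_galAdicCompletionMap`) and §R — the case split of ★ 72-NW §T1 VERBATIM, over §U ∕ §R BY NAME.  This is the socket the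
K4′ NOT-WILD head (68-I-NW) calls with `hsplit := ‹68-H›`; rule-26 token `hv`. [cite: Rogawski1990, §12.6 Prop. 12.6.1 (a) p. 188] [cite: SchneiderStuhler1997, §III.4] [cite: Kottwitz1988, §2] -/
theorem innerG_char_self_eq_one_of_hsplit_of_not_wild
    (hns : ∀ w : PlacesOver L v, IsCMField.complexConj L • w.1 = w.1) (hv : Algebra.IsUnramifiedIn (𝓞 L) v.asIdeal ∨ Valued.v (2 : v.adicCompletion ↥(maximalRealSubfield L)) = 1)
    [MeasurableSpace (Gqs L v)] [BorelSpace (Gqs L v)]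
    [∀ γ : Gqs L v, MeasurableSpace (Gqs L v ⧸ Subgroup.centralizer ({γ} : Set (Gqs L v)))] [∀ γ : Gqs L v, BorelSpace (Gqs L v ⧸ Subgroup.centralizer ({γ} : Set (Gqs L v)))]
    [MeasurableSpace (Gqs L v ⧸ Subgroup.center (Gqs L v))]
    {H : Type} [Group H] [TopologicalSpace H] [IsTopologicalGroup H] [MeasurableSpace H]
    (νQv : Measure (Gqs L v)) [νQv.IsHaarMeasure] [νQv.IsMulRightInvariant] (mQv : OrbitalMeasureFamily (Gqs L v))
    (hcanQ : mQv.IsCanonical (fun γ => IsRegularElt (γ.val : GL (Fin 3) (UnitaryGroup.LocalRing L v))) νQv)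
    (𝔇 : EllipticData (Gqs L v) H) (hμG : 𝔇.μG = νQv) (horb : 𝔇.orb = mQv)
    (hreg : ∀ γ : Gqs L v, γ ∈ 𝔇.regG ↔ IsRegularElt (γ.val : GL (Fin 3) (UnitaryGroup.LocalRing L v)))
    (hE : ∀ γ : Gqs L v, γ ∈ 𝔇.ellG ↔ IsRegularElt (γ.val : GL (Fin 3) (UnitaryGroup.LocalRing L v)) ∧ γ ∉ hyperbolicSet L v)
    (hM1 : ∀ π : IrrClass (Gqs L v), Measurable (𝔇.char π) ∧ LocallyIntegrable (𝔇.char π) 𝔇.μG ∧ (∀ x ∈ 𝔇.regG, ∀ᶠ y in 𝓝 x, 𝔇.char π y = 𝔇.char π x) ∧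
      ∀ φ : Gqs L v → ℂ, IsLocSmooth φ → π.smoothTrace 𝔇.μG φ = ∫ x, φ x * 𝔇.char π x ∂𝔇.μG)
    (hWIF : 𝔇.WeylIntegrationFormula) (hC1 : 𝔇.EllCartanSubset) (hC2 : 𝔇.EllCartanAE) (hC3 : 𝔇.NonEllCartanAE) (hL2 : 𝔇.L2CharOnTorusAll)   -- ★ PCT-OUT's extra letters
    (r : SmoothIrrep (Gqs L v))
    -- every SMOOTH self-extension of `r.ρ` splits (the ONLY family binder; ★ 59-F's text VERBATIM)
    (hsplit : ∀ (E : Type) [AddCommGroup E] [Module ℂ E] (ρE : Representation ℂ (Gqs L v) E), ρE.IsSmooth →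
      ∀ (i : r.ρ.IntertwiningMap ρE) (p : ρE.IntertwiningMap r.ρ), Function.Injective i → LinearMap.ker p.toLinearMap = LinearMap.range i.toLinearMap →
        Function.Surjective p → ∃ s : r.ρ.IntertwiningMap ρE, p.comp s = Representation.IntertwiningMap.id r.ρ) :
    𝔇.innerG (𝔇.char (IrrClass.mk r)) (𝔇.char (IrrClass.mk r)) = 1 := by
  obtain ⟨w⟩ : Nonempty (PlacesOver L v) := inferInstance
  have hw : IsCMField.complexConj L • w.1 = w.1 := hns w
  have hc1 : IsCMField.complexConj L ≠ 1 := IsCMField.complexConj_ne_one L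
  -- the one-place model re-read on the literal form `Φ₃ = antidiag(1,1,1)` (★ (G3) :189–:196)
  have hJw : placeForm (qsForm L) w.1 = (StdForm.antidiagonal 3).over (w.1.adicCompletion L) := by
    rw [placeForm, qsForm, antidiagOne_eq_over, StdForm.over_map]
  obtain ⟨eA, heA⟩ : ∃ eA : Gqs L v ≃ₜ* ↥(unitaryGroupOfForm (galAdicCompletionMap (L := L) (IsCMField.complexConj L) hw) ((StdForm.antidiagonal 3).over (w.1.adicCompletion L))),
      ∀ g : Gqs L v, ((eA g : ↥(unitaryGroupOfForm (galAdicCompletionMap (L := L) (IsCMField.complexConj L) hw) ((StdForm.antidiagonal 3).over (w.1.adicCompletion L)))) :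
          GL (Fin 3) (w.1.adicCompletion L)) =
        ((localNonsplitEquiv (IsCMField.complexConj L) (qsForm L) hc1 w hw g :
          ↥(unitaryGroupOfForm (galAdicCompletionMap (L := L) (IsCMField.complexConj L) hw) (placeForm (qsForm L) w.1))) : GL (Fin 3) (w.1.adicCompletion L)) := by
    rw [← hJw]
    exact ⟨localNonsplitEquiv (IsCMField.complexConj L) (qsForm L) hc1 w hw, fun g => rfl⟩
  -- the place token: unramified (the datum, §U) or odd residue characteristic (the tame block, §R), exactly as ★ (G3)-NOT-WILD ∕ ★ 72-NW §T1
  rcases hv with hunr | h2v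
  · obtain ⟨ϖ, hd⟩ := unramifiedLocalConjDatum_adicCompletion (IsCMField.complexConj L) hc1 v w hw hunr
    exact innerG_char_self_eq_one_of_hsplit_of_unramified_explicit L v hns w hw hd eA heA νQv mQv hcanQ 𝔇 hμG horb hreg hE hM1 hWIF hC1 hC2 hC3 hL2 r hsplit
  · by_cases he : v.asIdeal.ramificationIdx' w.1.asIdeal = 1
    · haveI : Algebra.IsQuadraticExtension ↥(maximalRealSubfield L) L := IsCMField.isQuadraticExtension L
      have hunr : Algebra.IsUnramifiedIn (𝓞 L) v.asIdeal := isUnramifiedIn_of_ramificationIdx'_eq_one L (IsCMField.complexConj L) v hc1 w hw he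
      obtain ⟨ϖ, hd⟩ := unramifiedLocalConjDatum_adicCompletion (IsCMField.complexConj L) hc1 v w hw hunr
      exact innerG_char_self_eq_one_of_hsplit_of_unramified_explicit L v hns w hw hd eA heA νQv mQv hcanQ 𝔇 hμG horb hreg hE hM1 hWIF hC1 hC2 hC3 hL2 r hsplit
    · have h2w : Valued.v (2 : w.1.adicCompletion L) = 1 := (valued_two_eq_one_iff_of_placesOver L w).2 h2v
      have hσ : ∀ x, (galAdicCompletionMap (L := L) (IsCMField.complexConj L) hw) ((galAdicCompletionMap (L := L) (IsCMField.complexConj L) hw) x) = x :=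
        galAdicCompletionMap_galAdicCompletionMap_of_smul_eq (IsCMField.complexConj L) w hc1 hw
      have hvσ : ∀ x, Valued.v ((galAdicCompletionMap (L := L) (IsCMField.complexConj L) hw) x) = Valued.v x := fun x =>
        valued_galAdicCompletionMap (L := L) (IsCMField.complexConj L) hw x
      obtain ⟨ϖ, hϖ, hσϖ, hres, hnorm⟩ := ramifiedBlock_adicCompletion L v w hw he h2w
      exact innerG_char_self_eq_one_of_hsplit_of_neg_explicit L v hns w hw hσ hvσ hϖ hσϖ hres h2w hnorm eA heA νQv mQv hcanQ 𝔇 hμG horb hreg hE hM1 hWIF hC1 hC2 hC3 hL2 r hsplit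
end Summit.HodgeConjecture.HodgeConjecture.Cruxes.H413.F0P3cStCharTSEPNormOneOfHsplit

end
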